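/-
Copyright (c) 2026. All rights reserved.
Released under Apache 2.0 license as described in the file LICENSE.
Authors: abc-iut cell, prover seat abc-iut-w5-d144 (gen 6; row «COR510iv-SB′», brick E input «D1b-TS»), over abc-iut-L4-t3's
`IotaOverTS` / `LamOverLink` add-ons, abc-iut-L4-t5's `logObsFamilyTS`; twin of this seat's `LogFrobeniusObservablesOver.lean`.
-/
import Literature.AnabelianGeometry.AbsoluteAnabelian.DiagramChainFamiliesOver
import Literature.AnabelianGeometry.AbsoluteAnabelian.DiagramOverTransport
import Literature.AnabelianGeometry.AbsoluteAnabelian.LogFrobeniusLamOverLink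
import Literature.AnabelianGeometry.AbsoluteAnabelian.LogFrobeniusObservablesTSOfIotaSquare
import HarnessLib

/-!
# [AbsTopIII] Cor 5.5 (iii) / Def 5.4 (iv)(vii): the homotopies of the observable `S_log_v` (the `TS`-valued half) lie over `Th•[Z]`

S. Mochizuki, *Topics in absolute anabelian geometry III: global reconstruction algorithms*,
J. Math. Sci. Univ. Tokyo 22 (2015) 939–1156 [MochizukiAbsTopIII2015]; manuscript `paper:url-5493eb38cbb7`: Def 5.4 (iv)
p. 127 ("`λ_{v,ν}` … obtained by composing … with `𝒩⊞_v → 𝒩_v` … lie over `Th•[Z]`"), (vii) p. 128 (the `ι_{v,ε}`), Cor 5.5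
(iii) p. 131 (the observable `S_log_v` on the portion of `D•_{≤3}` indexed by `v`, observation vertex `𝒩_v`), Rmk 3.5.1 p. 78.

The `TS` twin of `LogFrobeniusObservablesOver.lean`.  The observable's diagram `(D•_{≤3})_v ∪ {𝒩_v}` (`logDiagramTS v`) LIES
OVER `Th•[Z] = ℰ•` through `𝒳_⋎, □ ↦ proj`, `𝒩⊞_w ↦ (𝒩⊞_w → 𝒩_w → Th•[Z])`, `𝒩_v ↦ (𝒩_v → Th•[Z])`, the arrows lying over by
`logOver`, the unitor, `lamOver w ν` and — for the observation arrow `𝒩⊞_v → 𝒩_v` — the identity (`logTSOverE v`).  With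
respect to it:

* `isOver_logGenHomTS` — GIVEN abc-iut-L4-t3's add-ons `IotaOverTS T` (the `TS`-valued `ι_{v,ε}` lie over `Th•[Z]`) and
  `LamOverLink`, both printed kinds of generator pairs of `S_log_v` (abc-iut-L4-t5's `LogGenTS.pre` / `.post`, homotopy
  `logGenHomTS`) carry OVER-homotopies;
* `isOver_logObsFamilyTS_η` — ★ hence EVERY homotopy of abc-iut-L4-t5's constructed `logObsFamilyTS v T hsqTS` lies over
  `Th•[Z]` (this seat's `isOver_chainFamily_η`): the hypothesis «hoverTS» of the Cor 5.10 (iv)(b) compatibility closer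
  (row «COR510iv-SB′», abc-iut-f-101's brick D2) in over-datum form; `_map` over any category under `Th•[Z]`.

Interface-level (hypotheses `IotaOverTS`, `LamOverLink`, `IotaSquaresCommuteTS`; no carrier); nothing here bears on
[IUTchIII] Cor. 3.12; no side taken; typed ≠ proved.
-/

universe u

open CategoryTheory Quiver

namespace Literature.AnabelianGeometry.AbsoluteAnabelian

namespace LogFrobeniusSetting

variable {Vmod : Type u} {isArc : Vmod → Bool} (L : LogFrobeniusSetting Vmod isArc) (v : Vmod)

/-! ## The `TS`-observable's diagram over `Th•[Z]` -/

/-- Structure functor of a vertex of the portion `(D•_{≤3})_v` towards `Th•[Z]`: `𝒳_⋎, □ ↦ proj`, `𝒩⊞_w ↦ 𝒩⊞_w → 𝒩_w → Th•[Z]`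
(the other vertices do not occur). [cite: MochizukiAbsTopIII2015, Remark 3.5.1 p.78] -/
def tsN : (x : DVertex Vmod isArc) → InPortionThree v x → (x.category L ⥤ L.E)
  | .row1 _, _ => L.proj
  | .core, _ => L.proj
  | .nplus w, _ => L.forget w ⋙ L.toE w
  | .nv _, h => absurd h (by rintro (h | h) <;> [exact absurd h.2 (by change ¬ (4 ≤ 2); decide); cases h])
  | .e5, h => absurd h (by rintro (h | h) <;> [exact absurd h.2 (by change ¬ (5 ≤ 2); decide); cases h])
  | .an, h => absurd h (by rintro (h | h) <;> [exact absurd h.2 (by change ¬ (6 ≤ 2); decide); cases h])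
  | .e7, h => absurd h (by rintro (h | h) <;> [exact absurd h.2 (by change ¬ (7 ≤ 2); decide); cases h])
  | .nmonoPlus _, h => absurd h (by rintro (h | h) <;> [exact h.1.elim; cases h])
  | .nmono _, h => absurd h (by rintro (h | h) <;> [exact h.1.elim; cases h])
  | .emono5, h => absurd h (by rintro (h | h) <;> [exact h.1.elim; cases h])
  | .anMono, h => absurd h (by rintro (h | h) <;> [exact h.1.elim; cases h])
  | .emono7, h => absurd h (by rintro (h | h) <;> [exact h.1.elim; cases h])

/-- The arrows of the portion lie over `Th•[Z]`: `log` by `logOver`, `id_⋎` by the unitor, `λ⊞_{w,ν}` by `lamOver w ν`.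
[cite: MochizukiAbsTopIII2015, Def 5.4 (iv) p. 127] -/
def tsμ : ∀ {x y : DVertex Vmod isArc} (e : DEdge isArc x y) (hx : InPortionThree v x) (hy : InPortionThree v y),
    DEdge.functor L e ⋙ L.tsN v y hy ≅ L.tsN v x hx
  | _, _, .log _, _, _ => L.logOver
  | _, _, .toCore _, _, _ => L.proj.leftUnitor
  | _, _, .lam w ν _, _, _ => L.lamOver w ν
  | _, _, .forget _, _, hy => absurd hy (by rintro (h | h) <;> [exact absurd h.2 (by change ¬ (4 ≤ 2); decide); cases h])
  | _, _, .toE _, hx, _ => absurd hx (by rintro (h | h) <;> [exact absurd h.2 (by change ¬ (4 ≤ 2); decide); cases h])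
  | _, _, .κAn, hx, _ => absurd hx (by rintro (h | h) <;> [exact absurd h.2 (by change ¬ (5 ≤ 2); decide); cases h])
  | _, _, .anToE, hx, _ => absurd hx (by rintro (h | h) <;> [exact absurd h.2 (by change ¬ (6 ≤ 2); decide); cases h])
  | _, _, .monoNplus _, _, hy => absurd hy (by rintro (h | h) <;> [exact h.1.elim; cases h])
  | _, _, .monoN _, hx, _ => absurd hx (by rintro (h | h) <;> [exact absurd h.2 (by change ¬ (4 ≤ 2); decide); cases h])
  | _, _, .monoE5, hx, _ => absurd hx (by rintro (h | h) <;> [exact absurd h.2 (by change ¬ (5 ≤ 2); decide); cases h])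
  | _, _, .monoAn, hx, _ => absurd hx (by rintro (h | h) <;> [exact absurd h.2 (by change ¬ (6 ≤ 2); decide); cases h])
  | _, _, .monoE7, hx, _ => absurd hx (by rintro (h | h) <;> [exact absurd h.2 (by change ¬ (7 ≤ 2); decide); cases h])
  | _, _, .forgetMono _, hx, _ => absurd hx (by rintro (h | h) <;> [exact h.1.elim; cases h])
  | _, _, .toEmono _, hx, _ => absurd hx (by rintro (h | h) <;> [exact h.1.elim; cases h])
  | _, _, .κAnMono, hx, _ => absurd hx (by rintro (h | h) <;> [exact h.1.elim; cases h])
  | _, _, .anMonoToE, hx, _ => absurd hx (by rintro (h | h) <;> [exact h.1.elim; cases h])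

/-- The observation arrow `𝒩⊞_v → 𝒩_v` lies over `Th•[Z]` by the identity. [cite: MochizukiAbsTopIII2015, Def 5.4 (iv) p. 127] -/
def tsμObs : ∀ {x : DVertex Vmod isArc} (i : DEdge isArc x (.nv v)) (hx : InPortionThree v x),
    DEdge.functor L i ⋙ L.toE v ≅ L.tsN v x hx
  | _, .forget _, _ => Iso.refl _

/-- **The `TS`-observable's diagram `(D•_{≤3})_v ∪ {𝒩_v}` over `Th•[Z]`** (abc-iut-L4-t12's `OverData`).
[cite: MochizukiAbsTopIII2015, Remark 3.5.1 p.78] -/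
def logTSOverE : (L.logDiagramTS v).OverData L.E where
  N a := match a with
    | ExtVertex.base a => L.tsN v a.1 a.2
    | ExtVertex.obs => L.toE v
  μ {a b} e := match a, b, e with
    | ExtVertex.base a, ExtVertex.base b, e => L.tsμ v e a.2 b.2
    | ExtVertex.base a, ExtVertex.obs, i => L.tsμObs v i a.2
    | ExtVertex.obs, ExtVertex.base _, j => PEmpty.elim j
    | ExtVertex.obs, ExtVertex.obs, e => PEmpty.elim e

/-- The structure functor at the observation vertex is `𝒩_v → Th•[Z]`. [cite: MochizukiAbsTopIII2015, Remark 3.5.1 p.78] -/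
@[simp] theorem logTSOverE_N_obs : (L.logTSOverE v).N (logShapeTS (isArc := isArc) v).obs = L.toE v := rfl

/-- The over-isomorphism of `λ⊞_{v,ν}` is `lamOver v ν`. [cite: MochizukiAbsTopIII2015, Def 5.4 (iv) p. 127] -/
@[simp] theorem logTSOverE_μ_lamEdgeTS (ν : LogVertex (isArc v)) (hν : ν.isPostLog = false) :
    (L.logTSOverE v).μ (lamEdgeTS v ν hν) = L.lamOver v ν := rfl

/-- The over-isomorphism of `𝒩⊞_v → 𝒩_v` is the identity. [cite: MochizukiAbsTopIII2015, Def 5.4 (iv) p. 127] -/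
@[simp] theorem logTSOverE_μ_forgetEdgeTS : (L.logTSOverE v).μ (forgetEdgeTS (isArc := isArc) v) = Iso.refl _ := rfl

/-- The over-isomorphism of `id_⋎` is the unitor. [cite: MochizukiAbsTopIII2015, Cor 5.5 p. 130] -/
@[simp] theorem logTSOverE_μ_toCoreEdgeTS (n : ℤ) : (L.logTSOverE v).μ (toCoreEdgeTS v n) = L.proj.leftUnitor := rfl

/-- The over-isomorphism of `log` is `logOver`. [cite: MochizukiAbsTopIII2015, Def 5.4 (ii) p. 125] -/
@[simp] theorem logTSOverE_μ_logEdgeTS (n : ℤ) : (L.logTSOverE v).μ (logEdgeTS v n) = L.logOver := rfl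

/-! ## Bookkeeping -/

/-- `F.map` respects heterogeneous equality of morphisms with equal endpoints. [folklore] -/
private theorem map_heqTS {C D : Type*} [Category C] [Category D] (F : C ⥤ D) {X Y X' Y' : C} {f : X ⟶ Y} {g : X' ⟶ Y'}
    (hX : X = X') (hY : Y = Y') (h : HEq f g) : HEq (F.map f) (F.map g) := by
  subst hX hY
  cases h
  rfl

/-- Components of a natural transformation at equal objects are heterogeneously equal. [folklore] -/
private theorem app_heqTS {C D : Type*} [Category C] [Category D] {F G : C ⥤ D} (α : F ⟶ G) {y y' : C} (h : y = y') :
    HEq (α.app y) (α.app y') := by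
  subst h
  rfl

/-- Cancellation `f ∘ A⁻¹ ∘ A = f` for components of a natural isomorphism (bookkeeping, stated for clean rewriting).
[folklore] -/
private theorem comp_inv_hom_app {C D : Type*} [Category C] [Category D] {F G : C ⥤ D} (α : F ≅ G) (y : C) {W : D}
    (f : W ⟶ G.obj y) : (f ≫ α.inv.app y) ≫ α.hom.app y = f := by
  simp

/-- Cancellation `g ∘ f ∘ A⁻¹ ∘ A = g ∘ f` (bookkeeping). [folklore] -/
private theorem comp_comp_inv_hom_app {C D : Type*} [Category C] [Category D] {F G : C ⥤ D} (α : F ≅ G) (y : C)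
    {W W' : D} (g : W ⟶ W') (f : W' ⟶ G.obj y) : ((g ≫ f) ≫ α.inv.app y) ≫ α.hom.app y = g ≫ f := by
  simp

/-- The empty path at `𝒳_{⋎+1}` of the portion (bookkeeping abbreviation). [cite: MochizukiAbsTopIII2015, Definition 3.5 (i) p.75] -/
private abbrev nilRow1TS (n : ℤ) :
    Quiver.Path ((logShapeTS (isArc := isArc) v).base ⟨DVertex.row1 (n + 1), row1_mem_portion v (n + 1)⟩)
      ((logShapeTS (isArc := isArc) v).base ⟨DVertex.row1 (n + 1), row1_mem_portion v (n + 1)⟩) :=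
  Quiver.Path.nil

/-- The path functor of the empty path on objects. [cite: MochizukiAbsTopIII2015, Definition 3.5 (i) p.75] -/
private theorem pf_nil_objTS (c : (logShapeTS (isArc := isArc) v).Vertex) (x : (L.logDiagramTS v).obj c) :
    ((L.logDiagramTS v).pathFunctor (Quiver.Path.nil : Quiver.Path c c)).obj x = x :=
  (L.logDiagramTS v).pathFunctor_nil_obj c x

/-! ## The `TS`-valued `ι_{v,ε}` over `Th•[Z]`, componentwise (from `IotaOverTS`) -/

variable {L} in
/-- Along a PRE-log edge: `(𝒩_v → Th•[Z])(ι_{v,ε,X}) ≍ A_{ν₁,X} ∘ A_{ν₂,X}⁻¹` (`A := lamOver`).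
[cite: MochizukiAbsTopIII2015, Def 5.4 (vii) p. 128] -/
theorem TSHomotopies.IotaOverTS.toE_map_iota_heq_of_preLog {T : L.TSHomotopies} (hι : T.IotaOverTS) (v : Vmod)
    {ν₁ ν₂ : LogVertex (isArc v)} (ε : LogEdgeTS (isArc v) ν₁ ν₂) (h₁ : ν₁.isPostLog = false) (X₀ : L.X) :
    HEq ((L.toE v).map ((T.iota v ε).app X₀)) ((L.lamOver v ν₁).hom.app X₀ ≫ (L.lamOver v ν₂).inv.app X₀) := by
  rw [hι.app v ε X₀]
  have k : ((frobeniusTwist L.log ν₁.isPostLog ⋙ L.lam v ν₁) ⋙ L.forget v ⋙ L.toE v).obj X₀ =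
      (L.lam v ν₁ ⋙ L.forget v ⋙ L.toE v).obj X₀ := by
    rw [h₁]; rfl
  exact heq_comp k rfl rfl (L.lamTwistOver_hom_app_heq_of_preLog v ν₁ h₁ X₀) HEq.rfl

variable {L} in
/-- Along a POST-log edge, through the space-link's over-structure (GIVEN `LamOverLink`):
`(𝒩_v → Th•[Z])(ι_{v,ε,X}) ≍ A_{space-link, log X} ∘ Ξ_X ∘ A_{ν₂,X}⁻¹`. [cite: MochizukiAbsTopIII2015, Cor 5.5 p. 130] -/
theorem TSHomotopies.IotaOverTS.toE_map_iota_heq_spaceLink {T : L.TSHomotopies} (hι : T.IotaOverTS) (hΛ : L.LamOverLink) (v : Vmod)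
    {ν₁ ν₂ : LogVertex (isArc v)} (ε : LogEdgeTS (isArc v) ν₁ ν₂) (h₁ : ν₁.isPostLog = true) (X₀ : L.X) :
    HEq ((L.toE v).map ((T.iota v ε).app X₀))
      ((L.lamOver v (LogVertex.spaceLink (isArc v))).hom.app (L.log.obj X₀) ≫ L.logOver.hom.app X₀ ≫
        (L.lamOver v ν₂).inv.app X₀) := by
  rw [hι.app v ε X₀]
  have k : ((frobeniusTwist L.log ν₁.isPostLog ⋙ L.lam v ν₁) ⋙ L.forget v ⋙ L.toE v).obj X₀ =
      (L.lam v ν₁ ⋙ L.forget v ⋙ L.toE v).obj (L.log.obj X₀) := by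
    rw [h₁]; rfl
  refine ((heq_comp k rfl rfl (L.lamTwistOver_hom_app_heq_of_postLog v ν₁ h₁ X₀) HEq.rfl).trans
    (heq_of_eq (Category.assoc _ _ _))).trans ?_
  obtain rfl : ν₁ = LogVertex.postLog (isArc v) := LogVertex.eq_postLog_of_isPostLog _ h₁
  have k' : (L.lam v (LogVertex.postLog (isArc v)) ⋙ L.forget v ⋙ L.toE v).obj (L.log.obj X₀) =
      (L.lam v (LogVertex.spaceLink (isArc v)) ⋙ L.forget v ⋙ L.toE v).obj (L.log.obj X₀) := by
    rw [L.lam_spaceLink_eq_postLog v]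
  exact heq_comp k' rfl rfl (hΛ.hom_app_heq v (L.log.obj X₀)).symm HEq.rfl

/-! ## The structure isomorphisms along the `TS`-observable's generator paths, componentwise -/

/-- Along `[𝒩⊞_v → 𝒩_v] ∘ [λ⊞_{v,ν}]`: the structure isomorphism is `lamOver v ν`.
[cite: MochizukiAbsTopIII2015, Def 5.4 (iv) p. 127] -/
theorem pathIso_lamPathTS_hom_app_heq (ν : LogVertex (isArc v)) (hν : ν.isPostLog = false) (x : L.X) :
    HEq (((L.logTSOverE v).pathIso (lamPathTS v ν hν)).hom.app x) ((L.lamOver v ν).hom.app x) := by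
  have hy₀ := L.pf_nil_objTS v ((logShapeTS (isArc := isArc) v).base ⟨.core, core_mem_portion v⟩) x
  have hy₁ : ((L.logDiagramTS v).pathFunctor (Path.nil.cons (lamEdgeTS v ν hν))).obj x = (L.lam v ν).obj x :=
    (Functor.congr_obj ((L.logDiagramTS v).pathFunctor_cons Path.nil (lamEdgeTS v ν hν)) x).trans
      (congrArg (L.lam v ν).obj hy₀)
  rw [show lamPathTS (isArc := isArc) v ν hν = (Path.nil.cons (lamEdgeTS v ν hν)).cons (forgetEdgeTS v) from rfl,
    DiagramOfCategories.OverData.pathIso_cons_app, DiagramOfCategories.OverData.pathIso_cons_app,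
    DiagramOfCategories.OverData.pathIso_nil_app, logTSOverE_μ_lamEdgeTS, logTSOverE_μ_forgetEdgeTS]
  refine (eqToHom_comp_heq _ _).trans ?_
  have e1 : HEq ((Iso.refl (DEdge.functor L (DEdge.forget v) ⋙ L.toE v)).hom.app
      (((L.logDiagramTS v).pathFunctor (Path.nil.cons (lamEdgeTS v ν hν))).obj x))
      (𝟙 ((L.lam v ν ⋙ L.forget v ⋙ L.toE v).obj x)) := by
    rw [hy₁]
    exact heq_of_eq (by simp; rfl)
  have e2 : HEq ((L.lamOver v ν).hom.app (((L.logDiagramTS v).pathFunctor (Quiver.Path.nil : Quiver.Path ((logShapeTS (isArc := isArc) v).base ⟨DVertex.core, core_mem_portion v⟩) ((logShapeTS (isArc := isArc) v).base ⟨DVertex.core, core_mem_portion v⟩))).obj x))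
      ((L.lamOver v ν).hom.app x) := app_heqTS _ hy₀
  refine (heq_comp (by rw [hy₁]; try rfl) (by rw [hy₁]; try rfl) rfl e1
    ((eqToHom_comp_heq _ _).trans ((comp_eqToHom_heq _ _).trans e2))).trans ?_
  exact heq_of_eq (Category.id_comp _)

/-- Along `[𝒩⊞_v → 𝒩_v] ∘ [λ⊞_{ν₂}] ∘ [id_{⋎+1}]`: the structure isomorphism is `lamOver v ν₂`.
[cite: MochizukiAbsTopIII2015, Def 5.4 (iv) p. 127] -/
theorem pathIso_postLogCodPathTS_hom_app_heq (n : ℤ) (ν₂ : LogVertex (isArc v)) (h₂ : ν₂.isPostLog = false) (x : L.X) :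
    HEq (((L.logTSOverE v).pathIso (postLogCodPathTS v n ν₂ h₂)).hom.app x) ((L.lamOver v ν₂).hom.app x) := by
  have hy₀ := L.pf_nil_objTS v ((logShapeTS (isArc := isArc) v).base ⟨.row1 (n + 1), row1_mem_portion v (n + 1)⟩) x
  have hy₁ : ((L.logDiagramTS v).pathFunctor (Path.nil.cons (toCoreEdgeTS v (n + 1)))).obj x = x :=
    (Functor.congr_obj ((L.logDiagramTS v).pathFunctor_cons Path.nil (toCoreEdgeTS v (n + 1))) x).trans hy₀
  have hy₂ : ((L.logDiagramTS v).pathFunctor ((Path.nil.cons (toCoreEdgeTS v (n + 1))).cons (lamEdgeTS v ν₂ h₂))).obj x =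
      (L.lam v ν₂).obj x :=
    (Functor.congr_obj ((L.logDiagramTS v).pathFunctor_cons (Path.nil.cons (toCoreEdgeTS v (n + 1)))
      (lamEdgeTS v ν₂ h₂)) x).trans (congrArg (L.lam v ν₂).obj hy₁)
  rw [show postLogCodPathTS (isArc := isArc) v n ν₂ h₂ =
      ((Path.nil.cons (toCoreEdgeTS v (n + 1))).cons (lamEdgeTS v ν₂ h₂)).cons (forgetEdgeTS v) from rfl,
    DiagramOfCategories.OverData.pathIso_cons_app, DiagramOfCategories.OverData.pathIso_cons_app,
    DiagramOfCategories.OverData.pathIso_cons_app, DiagramOfCategories.OverData.pathIso_nil_app,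
    logTSOverE_μ_lamEdgeTS, logTSOverE_μ_forgetEdgeTS, logTSOverE_μ_toCoreEdgeTS]
  refine (eqToHom_comp_heq _ _).trans ?_
  have e1 : HEq ((Iso.refl (DEdge.functor L (DEdge.forget v) ⋙ L.toE v)).hom.app
      (((L.logDiagramTS v).pathFunctor ((Path.nil.cons (toCoreEdgeTS v (n + 1))).cons (lamEdgeTS v ν₂ h₂))).obj x))
      (𝟙 ((L.lam v ν₂ ⋙ L.forget v ⋙ L.toE v).obj x)) := by
    rw [hy₂]
    exact heq_of_eq (by simp; rfl)
  have e2 : HEq ((L.lamOver v ν₂).hom.app (((L.logDiagramTS v).pathFunctor (Path.nil.cons (toCoreEdgeTS v (n + 1)))).obj x))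
      ((L.lamOver v ν₂).hom.app x) := app_heqTS _ hy₁
  have e3 : HEq (L.proj.leftUnitor.hom.app (((L.logDiagramTS v).pathFunctor (nilRow1TS (isArc := isArc) v n)).obj x))
      (𝟙 (L.proj.obj x)) := by
    rw [hy₀]
    exact heq_of_eq (by simp)
  have e23 : HEq ((L.lamOver v ν₂).hom.app (((L.logDiagramTS v).pathFunctor (Path.nil.cons (toCoreEdgeTS v (n + 1)))).obj x) ≫
      (eqToHom (by rw [DiagramOfCategories.pathFunctor_cons]; try rfl) ≫
        L.proj.leftUnitor.hom.app (((L.logDiagramTS v).pathFunctor (nilRow1TS (isArc := isArc) v n)).obj x) ≫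
        eqToHom (by rw [DiagramOfCategories.pathFunctor_nil]; try rfl)))
      ((L.lamOver v ν₂).hom.app x ≫ 𝟙 (L.proj.obj x)) :=
    heq_comp (by rw [hy₁]) (congrArg (fun y => L.proj.obj y) hy₁) rfl e2
      ((eqToHom_comp_heq _ _).trans ((comp_eqToHom_heq _ _).trans e3))
  refine (heq_comp (by rw [hy₂]; try rfl) (by rw [hy₂]; try rfl) rfl e1 ((eqToHom_comp_heq _ _).trans e23)).trans ?_
  exact heq_of_eq (by simp)

/-- Along `[𝒩⊞_v → 𝒩_v] ∘ [λ⊞_{space-link}] ∘ [id_⋎] ∘ [log]`: the structure isomorphism is `lamOver v space-link` at `log X`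
followed by `logOver` at `X`. [cite: MochizukiAbsTopIII2015, Def 5.4 (ii) p. 125] -/
theorem pathIso_postLogDomPathTS_hom_app_heq (n : ℤ) (hsl : (LogVertex.spaceLink (isArc v)).isPostLog = false) (x : L.X) :
    HEq (((L.logTSOverE v).pathIso (postLogDomPathTS v n hsl)).hom.app x)
      ((L.lamOver v (LogVertex.spaceLink (isArc v))).hom.app (L.log.obj x) ≫ L.logOver.hom.app x) := by
  have hy₀ := L.pf_nil_objTS v ((logShapeTS (isArc := isArc) v).base ⟨.row1 (n + 1), row1_mem_portion v (n + 1)⟩) x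
  have hy₁ : ((L.logDiagramTS v).pathFunctor (Path.nil.cons (logEdgeTS v n))).obj x = L.log.obj x :=
    (Functor.congr_obj ((L.logDiagramTS v).pathFunctor_cons Path.nil (logEdgeTS v n)) x).trans (congrArg L.log.obj hy₀)
  have hy₂ : ((L.logDiagramTS v).pathFunctor ((Path.nil.cons (logEdgeTS v n)).cons (toCoreEdgeTS v n))).obj x =
      L.log.obj x :=
    (Functor.congr_obj ((L.logDiagramTS v).pathFunctor_cons (Path.nil.cons (logEdgeTS v n)) (toCoreEdgeTS v n)) x).trans
      hy₁
  have hy₃ : ((L.logDiagramTS v).pathFunctor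
      (((Path.nil.cons (logEdgeTS v n)).cons (toCoreEdgeTS v n)).cons (lamEdgeTS v _ hsl))).obj x =
      (L.lam v (LogVertex.spaceLink (isArc v))).obj (L.log.obj x) :=
    (Functor.congr_obj ((L.logDiagramTS v).pathFunctor_cons ((Path.nil.cons (logEdgeTS v n)).cons (toCoreEdgeTS v n))
      (lamEdgeTS v _ hsl)) x).trans (congrArg (L.lam v (LogVertex.spaceLink (isArc v))).obj hy₂)
  rw [show postLogDomPathTS (isArc := isArc) v n hsl =
      ((((Path.nil.cons (logEdgeTS v n)).cons (toCoreEdgeTS v n)).cons (lamEdgeTS v _ hsl)).cons (forgetEdgeTS v))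
      from rfl,
    DiagramOfCategories.OverData.pathIso_cons_app, DiagramOfCategories.OverData.pathIso_cons_app,
    DiagramOfCategories.OverData.pathIso_cons_app, DiagramOfCategories.OverData.pathIso_cons_app,
    DiagramOfCategories.OverData.pathIso_nil_app,
    logTSOverE_μ_lamEdgeTS, logTSOverE_μ_forgetEdgeTS, logTSOverE_μ_toCoreEdgeTS, logTSOverE_μ_logEdgeTS]
  refine (eqToHom_comp_heq _ _).trans ?_
  have e1 : HEq ((Iso.refl (DEdge.functor L (DEdge.forget v) ⋙ L.toE v)).hom.app (((L.logDiagramTS v).pathFunctor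
      (((Path.nil.cons (logEdgeTS v n)).cons (toCoreEdgeTS v n)).cons (lamEdgeTS v _ hsl))).obj x))
      (𝟙 ((L.lam v (LogVertex.spaceLink (isArc v)) ⋙ L.forget v ⋙ L.toE v).obj (L.log.obj x))) := by
    rw [hy₃]
    exact heq_of_eq (by simp; rfl)
  have e2 : HEq ((L.lamOver v (LogVertex.spaceLink (isArc v))).hom.app
      (((L.logDiagramTS v).pathFunctor ((Path.nil.cons (logEdgeTS v n)).cons (toCoreEdgeTS v n))).obj x))
      ((L.lamOver v (LogVertex.spaceLink (isArc v))).hom.app (L.log.obj x)) := app_heqTS _ hy₂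
  have e3 : HEq (L.proj.leftUnitor.hom.app (((L.logDiagramTS v).pathFunctor (Path.nil.cons (logEdgeTS v n))).obj x))
      (𝟙 (L.proj.obj (L.log.obj x))) := by
    rw [hy₁]
    exact heq_of_eq (by simp)
  have e4 : HEq (L.logOver.hom.app (((L.logDiagramTS v).pathFunctor (nilRow1TS (isArc := isArc) v n)).obj x))
      (L.logOver.hom.app x) := app_heqTS _ hy₀
  have e34 : HEq (L.proj.leftUnitor.hom.app (((L.logDiagramTS v).pathFunctor (Path.nil.cons (logEdgeTS v n))).obj x) ≫
      (eqToHom (by rw [DiagramOfCategories.pathFunctor_cons]; try rfl) ≫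
        L.logOver.hom.app (((L.logDiagramTS v).pathFunctor (nilRow1TS (isArc := isArc) v n)).obj x) ≫
        eqToHom (by rw [DiagramOfCategories.pathFunctor_nil]; try rfl)))
      (𝟙 (L.proj.obj (L.log.obj x)) ≫ L.logOver.hom.app x) :=
    heq_comp (congrArg (fun y => L.proj.obj y) hy₁) (congrArg (fun y => L.proj.obj y) hy₁) rfl e3
      ((eqToHom_comp_heq _ _).trans ((comp_eqToHom_heq _ _).trans e4))
  have e234 : HEq ((L.lamOver v (LogVertex.spaceLink (isArc v))).hom.app
      (((L.logDiagramTS v).pathFunctor ((Path.nil.cons (logEdgeTS v n)).cons (toCoreEdgeTS v n))).obj x) ≫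
      (eqToHom (by rw [DiagramOfCategories.pathFunctor_cons]; try rfl) ≫
        (L.proj.leftUnitor.hom.app (((L.logDiagramTS v).pathFunctor (Path.nil.cons (logEdgeTS v n))).obj x) ≫
        (eqToHom (by rw [DiagramOfCategories.pathFunctor_cons]; try rfl) ≫
          L.logOver.hom.app (((L.logDiagramTS v).pathFunctor (nilRow1TS (isArc := isArc) v n)).obj x) ≫
          eqToHom (by rw [DiagramOfCategories.pathFunctor_nil]; try rfl)))))
      ((L.lamOver v (LogVertex.spaceLink (isArc v))).hom.app (L.log.obj x) ≫
        (𝟙 (L.proj.obj (L.log.obj x)) ≫ L.logOver.hom.app x)) :=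
    heq_comp (by rw [hy₂]; try rfl) (by rw [hy₂]; try rfl) rfl e2 ((eqToHom_comp_heq _ _).trans e34)
  refine (heq_comp (by rw [hy₃]; try rfl) (by rw [hy₃]; try rfl) rfl e1 ((eqToHom_comp_heq _ _).trans e234)).trans ?_
  exact heq_of_eq (by simp)

/-! ## The generator homotopies of `S_log_v` lie over `Th•[Z]` -/

/-- **Both printed kinds of generator pairs of `S_log_v` carry OVER-homotopies**, GIVEN `IotaOverTS T` and `LamOverLink`.
[cite: MochizukiAbsTopIII2015, Def 5.4 (vii) p. 128] -/
theorem isOver_logGenHomTS (T : L.TSHomotopies) (hι : T.IotaOverTS) (hΛ : L.LamOverLink) :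
    ∀ ⦃c b : (logShapeTS (isArc := isArc) v).Vertex⦄ ⦃g g' : Path c b⦄ (s : LogGenTS v g g'),
      (L.logTSOverE v).IsOver g g' (L.logGenHomTS v T s)
  | _, _, _, _, LogGenTS.pre ν₁ ν₂ ε h₁ h₂ => by
    refine (Iso.eq_comp_inv _).mpr ?_
    ext x
    rw [NatTrans.comp_app, Functor.whiskerRight_app]
    apply eq_of_heq
    refine HEq.trans ?_ (L.pathIso_lamPathTS_hom_app_heq v ν₁ h₁ x).symm
    have hθ : HEq (((L.logTSOverE v).N (logShapeTS (isArc := isArc) v).obs).map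
        ((L.logGenHomTS v T (LogGenTS.pre ν₁ ν₂ ε h₁ h₂)).app x))
        ((L.lamOver v ν₁).hom.app x ≫ (L.lamOver v ν₂).inv.app x) := by
      have k : HEq ((L.logGenHomTS v T (LogGenTS.pre ν₁ ν₂ ε h₁ h₂)).app x) ((T.iota v ε).app x) := by
        simp only [logGenHomTS, NatTrans.comp_app, eqToHom_app]
        exact (eqToHom_comp_heq _ _).trans (comp_eqToHom_heq _ _)
      exact (map_heqTS (L.toE v) (Functor.congr_obj (L.pathFunctor_lamPathTS v ν₁ h₁) x)
        (Functor.congr_obj (L.pathFunctor_lamPathTS' v ν₂ h₂) x).symm k).trans (hι.toE_map_iota_heq_of_preLog v ε h₁ x)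
    have hP := L.pathIso_lamPathTS_hom_app_heq v ν₂ h₂ x
    refine (heq_comp ?_ ?_ rfl hθ hP).trans (heq_of_eq (comp_inv_hom_app (L.lamOver v ν₂) x _))
    · exact (congrArg (fun F => (L.toE v).obj (F.obj x)) (L.pathFunctor_lamPathTS v ν₁ h₁)).trans (by rw [h₁]; try rfl)
    · exact congrArg (fun F => (L.toE v).obj (F.obj x)) (L.pathFunctor_lamPathTS' v ν₂ h₂).symm
  | _, _, _, _, LogGenTS.post ν₁ ν₂ ε h₁ h₂ hsl n => by
    refine (Iso.eq_comp_inv _).mpr ?_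
    ext x
    rw [NatTrans.comp_app, Functor.whiskerRight_app]
    apply eq_of_heq
    refine HEq.trans ?_ (L.pathIso_postLogDomPathTS_hom_app_heq v n hsl x).symm
    have hθ : HEq (((L.logTSOverE v).N (logShapeTS (isArc := isArc) v).obs).map
        ((L.logGenHomTS v T (LogGenTS.post ν₁ ν₂ ε h₁ h₂ hsl n)).app x))
        (((L.lamOver v (LogVertex.spaceLink (isArc v))).hom.app (L.log.obj x) ≫ L.logOver.hom.app x) ≫
          (L.lamOver v ν₂).inv.app x) := by
      have k : HEq ((L.logGenHomTS v T (LogGenTS.post ν₁ ν₂ ε h₁ h₂ hsl n)).app x) ((T.iota v ε).app x) := by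
        simp only [logGenHomTS, NatTrans.comp_app, eqToHom_app]
        exact (eqToHom_comp_heq _ _).trans (comp_eqToHom_heq _ _)
      refine (map_heqTS (L.toE v) (Functor.congr_obj (L.pathFunctor_postLogDomPathTS v ν₁ h₁ n hsl) x)
        (Functor.congr_obj (L.pathFunctor_postLogCodPathTS v n ν₂ h₂) x).symm k).trans ?_
      exact (hι.toE_map_iota_heq_spaceLink hΛ v ε h₁ x).trans (heq_of_eq (Category.assoc _ _ _).symm)
    have hP := L.pathIso_postLogCodPathTS_hom_app_heq v n ν₂ h₂ x
    refine (heq_comp ?_ ?_ rfl hθ hP).trans (heq_of_eq (comp_comp_inv_hom_app (L.lamOver v ν₂) x _ _))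
    · refine (congrArg (fun F => (L.toE v).obj (F.obj x)) (L.pathFunctor_postLogDomPathTS v ν₁ h₁ n hsl)).trans ?_
      rw [h₁, LogVertex.eq_postLog_of_isPostLog _ h₁, ← L.lam_spaceLink_eq_postLog v]
      rfl
    · exact congrArg (fun F => (L.toE v).obj (F.obj x)) (L.pathFunctor_postLogCodPathTS v n ν₂ h₂).symm

/-- ★ **Every homotopy of abc-iut-L4-t5's constructed observable `S_log_v` lies over `Th•[Z]`** (GIVEN `IotaOverTS`,
`LamOverLink`, and the `TS`-square hypothesis under which `logObsFamilyTS` exists): the hypothesis «hoverTS» of the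
Cor 5.10 (iv)(b) compatibility closer in over-datum form. [cite: MochizukiAbsTopIII2015, Cor 5.5 (iii) p. 131] -/
theorem isOver_logObsFamilyTS_η (T : L.TSHomotopies) (hι : T.IotaOverTS) (hΛ : L.LamOverLink)
    (hsq : L.IotaSquaresCommuteTS T v) {a b : (logShapeTS (isArc := isArc) v).Vertex} {p q : Path a b}
    (h : (L.logObsFamilyTS v T hsq).E p q) :
    (L.logTSOverE v).IsOver p q ((L.logObsFamilyTS v T hsq).η h) :=
  DiagramOfCategories.isOver_chainFamily_η (L.logTSOverE v) (LogGenTS v) (L.logGenHomTS v T)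
    (L.isOver_logGenHomTS v T hι hΛ) (logShapeTS v).obs (isEmpty_hom_logObsTS v)
    (fun p q c c' => L.chain_hom_eq_TS v T hsq p q c c') h

/-- The same over any category under `Th•[Z]` (abc-iut-f-101's `IsOver.map`). [cite: MochizukiAbsTopIII2015, Cor 5.10 (iv)(b) p. 147] -/
theorem isOver_logObsFamilyTS_η_map (T : L.TSHomotopies) (hι : T.IotaOverTS) (hΛ : L.LamOverLink)
    (hsq : L.IotaSquaresCommuteTS T v) {C' : Type (u + 1)} [Category.{u} C'] (F : L.E ⥤ C')
    {a b : (logShapeTS (isArc := isArc) v).Vertex} {p q : Path a b} (h : (L.logObsFamilyTS v T hsq).E p q) :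
    ((L.logTSOverE v).map F).IsOver p q ((L.logObsFamilyTS v T hsq).η h) :=
  DiagramOfCategories.OverData.IsOver.map F (L.isOver_logObsFamilyTS_η v T hι hΛ hsq h)

end LogFrobeniusSetting

end Literature.AnabelianGeometry.AbsoluteAnabelian
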